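import Summits.MatrixMultiplication.MatrixMultiplication.Theorems.FarEdgeDescentIsolatedSandwich
import HarnessLib

/-!
# Far-edge descent, kernel XXXIV-A: the FLAT CORNER of the isolated tower is rigid

Route `FarEdgeDescent`, special leaf `FiniteSaturation` (stmt-MatrixMultiplication-23739): helper
kernel, THESES-FREE and def-free.  The certified isolated improvable squaring tower (kernels
XXXII-A…D; numeric chain `r' = r²`, `L' = (Q+L)² − Q²`, `Q + 2L = r`, virtual mass
`G'(s,t) = (Q^t + G)² − (Q^t)²`, readout `G_j(s,t) ≤ r_j` at every sub-tangent `(s,t)` of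
`y ↦ ω(1,y,1)`) has order EXACTLY `θ_S = log(4/3)/log(3/2)` at the CUSP corner `(s,t) = (1,1)`
(kernels XXXIII-B/C: the readouts pass on a full wedge `s − 1 ≤ c(1−t)^κ`, `κ = log₂(4/3)`).
This kernel is the companion statement at the other corner of the certificate world, the FLAT
corner `(s,t) = (2,0)` (the line `s + y·t = 2`, tight for `ω(1,0,1) = 2`), which the THIN virtual
formats `(1,t,R)` of lens 1 (`SaturationLadder`, ASK-L2-47 / K48-V) see through the shadow
`(θ₀+θ₂, θ₁)` of a plane virtual point `θ = (θ₀,θ₁,θ₂)` (kernel XXXIV-B):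

* §1 elementary chords (`a^σ ≤ 1 + (a−1)σ`), `3^(−δ) ≤ 1 − 0.99δ` (`δ ≤ 1/100`), and the
  one-line optimisation `C·ε^κ − R·ε ≤ C^(1/(1−κ))·R^(−κ/(1−κ))` (`rpow_sub_mul_le`);
* §2 **the anchor-gain invariant** (`gain_invariant`): along the chain the FULL normalised readout
  `F_j = (Q_j^t + G_j)/r_j` obeys `F_{j+1} = F_j² + (Q_{j+1}^t − Q_j^{2t})/r_{j+1}` EXACTLY — plain
  squaring plus the ANCHOR GAIN of the free re-anchoring `Q_{j+1} = Q_j² + 2L_j²` (`anchor_sq`);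
  the gain is at most `(3^t − 1)·Q_j^{2t} ≤ 2t·r_{j+1}^t` (`gain_le`, from `L_j ≤ Q_j`), so a margin
  `F_0 ≤ 1 − x` with `x ≤ 1/2` propagates to every stage as soon as each gain is `≤ (x/2)·r_{j+1}`;
* §3 **flat-corner rigidity of the `E₃` tower** (`flatCorner_pass`): for `0 ≤ δ, τ ≤ 1/100` and
  `τ ≤ 3δ`, EVERY readout passes at `(2 − δ, τ)`: `G_j(2−δ, τ) ≤ r_j` for all `j`.  Near `(2,0)`
  the pass region of the whole tower is thus (at least) the LINEAR wedge `τ ≤ 3δ` of its base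
  (`4^τ + 3^(2−δ) ≤ 10`, slope `9 log 3/log 4 = 7.13…`; the tower's own limit slope is `6.942…`,
  instrument `thin_probe.py` of the lens memo): the squaring tower does NOT sharpen the flat corner
  — its only non-rigid corner is the cusp.  In particular the readouts pass at points with
  `τ > δ`, i.e. BEYOND the unit roof `θ₁ ≤ (1−θ₀) + (1−θ₂)` of `ω = 2`, which is what lets kernel
  XXXIV-B place admissible plane points of thin excess `≍ R^(−θ_S)` at every thin format.

References: Schönhage 1981, §5; Pan 1984 (LNCS 179) §16 Props. 16.2–16.5; Stothers 2010, Thm. 8;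
Knuth TAOCP 2, §4.6.4 Ex. 67(g) (the budget `Q + 2L = r`); Lotti–Romani 1983, Prop. 4.1.
Tags: `FiniteSaturation` (h₁) NEC · WEAKER · ATTACKED; instrument geometry (flat corner rigid).
-/

set_option linter.dupNamespace false

noncomputable section

open scoped BigOperators

namespace Summit.MatrixMultiplication.MatrixMultiplication.Theorems.FarEdgeDescentFlatCorner

open Literature.Computability.AlgebraicComplexity
open Summit.MatrixMultiplication.MatrixMultiplication.Theorems.FarEdgeDescentImprovableDynamics

/-! ## §1 Elementary bounds -/

/-- Weighted AM–GM chord of `σ ↦ a^σ` on `[0,1]`: `a^σ ≤ 1 + (a−1)σ` (`a ≥ 0`). [folklore] -/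
theorem rpow_le_chord {a σ : ℝ} (ha : 0 ≤ a) (hσ0 : 0 ≤ σ) (hσ1 : σ ≤ 1) :
    a ^ σ ≤ 1 + (a - 1) * σ := by
  have h := Real.geom_mean_le_arith_mean2_weighted (w₁ := 1 - σ) (w₂ := σ) (p₁ := 1) (p₂ := a)
    (by linarith) hσ0 zero_le_one ha (by ring)
  rw [Real.one_rpow, one_mul] at h
  linarith

/-- `(x^τ)² = (x²)^τ` for `x ≥ 0`. [folklore] -/
theorem rpow_sq_eq {x : ℝ} (hx : 0 ≤ x) (τ : ℝ) : (x ^ τ) ^ 2 = (x ^ 2) ^ τ := by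
  rw [← Real.rpow_natCast (x ^ τ) 2, ← Real.rpow_mul hx, ← Real.rpow_natCast x 2,
    ← Real.rpow_mul hx]
  push_cast
  ring_nf

/-- `4^τ ≤ 1 + 2τ` for `0 ≤ τ ≤ 1/2` (`4^τ = 2^(2τ)` and the chord of `2^σ`). [folklore] -/
theorem four_rpow_le {τ : ℝ} (hτ0 : 0 ≤ τ) (hτ : τ ≤ 1 / 2) : (4 : ℝ) ^ τ ≤ 1 + 2 * τ := by
  have e : (4 : ℝ) ^ τ = (2 : ℝ) ^ (2 * τ) := by
    rw [show (4 : ℝ) = (2 : ℝ) ^ (2 : ℝ) by rw [Real.rpow_two]; norm_num,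
      ← Real.rpow_mul (by norm_num)]
  rw [e]
  have h := rpow_le_chord (a := 2) (σ := 2 * τ) (by norm_num) (by linarith) (by linarith)
  linarith

/-- `100^τ ≤ 1 + 18τ` for `0 ≤ τ ≤ 1/2` (`100^τ = 10^(2τ)` and the chord of `10^σ`). [folklore] -/
theorem hundred_rpow_le {τ : ℝ} (hτ0 : 0 ≤ τ) (hτ : τ ≤ 1 / 2) : (100 : ℝ) ^ τ ≤ 1 + 18 * τ := by
  have e : (100 : ℝ) ^ τ = (10 : ℝ) ^ (2 * τ) := by
    rw [show (100 : ℝ) = (10 : ℝ) ^ (2 : ℝ) by rw [Real.rpow_two]; norm_num,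
      ← Real.rpow_mul (by norm_num)]
  rw [e]
  have h := rpow_le_chord (a := 10) (σ := 2 * τ) (by norm_num) (by linarith) (by linarith)
  linarith

/-- `3^τ − 1 ≤ 2τ` for `0 ≤ τ ≤ 1` (chord of `3^σ`). [folklore] -/
theorem three_rpow_sub_one_le {τ : ℝ} (hτ0 : 0 ≤ τ) (hτ1 : τ ≤ 1) : (3 : ℝ) ^ τ - 1 ≤ 2 * τ := by
  have h := rpow_le_chord (a := 3) (σ := τ) (by norm_num) hτ0 hτ1
  linarith

/-- `3^(−δ) ≤ 1 − 0.99·δ` for `0 ≤ δ ≤ 1/100` (`3^δ ≥ 1 + δ·log 3 ≥ 1 + δ`). [folklore] -/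
theorem three_rpow_neg_le {δ : ℝ} (hδ0 : 0 ≤ δ) (hδ : δ ≤ 1 / 100) :
    (3 : ℝ) ^ (-δ) ≤ 1 - 99 / 100 * δ := by
  have h3pos : (0 : ℝ) < (3 : ℝ) ^ δ := Real.rpow_pos_of_pos (by norm_num) δ
  have hlog : 1 ≤ Real.log 3 := by
    rw [Real.le_log_iff_exp_le (by norm_num)]
    have := Real.exp_one_lt_d9
    linarith
  have h3 : 1 + δ ≤ (3 : ℝ) ^ δ := by
    rw [Real.rpow_def_of_pos (by norm_num : (0 : ℝ) < 3)]
    calc 1 + δ ≤ Real.log 3 * δ + 1 := by nlinarith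
      _ ≤ Real.exp (Real.log 3 * δ) := Real.add_one_le_exp _
  have hA : 0 ≤ 1 - 99 / 100 * δ := by linarith
  have h4 : (1 - 99 / 100 * δ) * (1 + δ) ≤ (1 - 99 / 100 * δ) * (3 : ℝ) ^ δ :=
    mul_le_mul_of_nonneg_left h3 hA
  have h5 : 1 ≤ (1 - 99 / 100 * δ) * (1 + δ) := by nlinarith
  rw [Real.rpow_neg (by norm_num), inv_eq_one_div, div_le_iff₀ h3pos]
  linarith

/-- **One-line optimisation**: for `0 < κ < 1`, `C ≥ 0`, `R > 0` and every `ε ≥ 0`,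
`C·ε^κ − R·ε ≤ C^(1/(1−κ)) · R^(−κ/(1−κ))` (split at `V = (C/R)^(1/(1−κ))`, where `C·V^(κ−1) = R`).
[folklore] -/
theorem rpow_sub_mul_le {κ C R ε : ℝ} (hκ0 : 0 < κ) (hκ1 : κ < 1) (hC : 0 ≤ C) (hR : 0 < R)
    (hε : 0 ≤ ε) :
    C * ε ^ κ - R * ε ≤ C ^ (1 / (1 - κ)) * R ^ (-(κ / (1 - κ))) := by
  have h1κ : 0 < 1 - κ := by linarith
  have hRHS : 0 ≤ C ^ (1 / (1 - κ)) * R ^ (-(κ / (1 - κ))) :=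
    mul_nonneg (Real.rpow_nonneg hC _) (Real.rpow_nonneg hR.le _)
  rcases hC.eq_or_lt with hC0 | hCpos
  · rw [← hC0] at hRHS ⊢
    have : 0 ≤ R * ε := by positivity
    linarith [this, hRHS]
  set V : ℝ := (C / R) ^ (1 / (1 - κ)) with hV
  have hCR : 0 < C / R := div_pos hCpos hR
  have hVpos : 0 < V := Real.rpow_pos_of_pos hCR _
  by_cases hεV : ε ≤ V
  · -- `C ε^κ ≤ C V^κ = C^(1/(1-κ)) R^(-κ/(1-κ))`
    have h1 : C * ε ^ κ ≤ C * V ^ κ :=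
      mul_le_mul_of_nonneg_left (Real.rpow_le_rpow hε hεV hκ0.le) hC
    have hVκ : V ^ κ = C ^ (κ / (1 - κ)) * R ^ (-(κ / (1 - κ))) := by
      rw [hV, ← Real.rpow_mul hCR.le, Real.div_rpow hC hR.le, Real.rpow_neg hR.le,
        show 1 / (1 - κ) * κ = κ / (1 - κ) by ring]
      ring
    have h2 : C * V ^ κ = C ^ (1 / (1 - κ)) * R ^ (-(κ / (1 - κ))) := by
      rw [hVκ, ← mul_assoc]
      congr 1
      rw [show 1 / (1 - κ) = 1 + κ / (1 - κ) by field_simp; ring, Real.rpow_add hCpos,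
        Real.rpow_one]
    have h3 : 0 ≤ R * ε := by positivity
    linarith
  · -- `ε > V`: `C ε^κ = C ε^(κ-1) ε ≤ C V^(κ-1) ε = R ε`
    rw [not_le] at hεV
    have hεpos : 0 < ε := lt_trans hVpos hεV
    have h1 : ε ^ (κ - 1) ≤ V ^ (κ - 1) :=
      Real.rpow_le_rpow_of_nonpos hVpos hεV.le (by linarith)
    have hVκ : C * V ^ (κ - 1) = R := by
      rw [hV, ← Real.rpow_mul hCR.le, show 1 / (1 - κ) * (κ - 1) = -1 by field_simp; ring,
        Real.rpow_neg hCR.le, Real.rpow_one]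
      field_simp
    have e : C * ε ^ κ = C * ε ^ (κ - 1) * ε := by
      rw [mul_assoc, ← Real.rpow_add_one hεpos.ne' (κ - 1), sub_add_cancel]
    have h2 : C * ε ^ (κ - 1) * ε ≤ C * V ^ (κ - 1) * ε :=
      mul_le_mul_of_nonneg_right (mul_le_mul_of_nonneg_left h1 hC) hε
    rw [hVκ] at h2
    linarith

/-! ## §2 The anchor-gain invariant of an improvable chain -/

section Chain

variable (r Q L : ℕ → ℕ) (G : ℕ → ℝ → ℝ → ℝ)

/-- Pointwise non-negativity of the virtual mass along the chain: `G' = G(G + 2Q^t) ≥ 0`.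
[folklore] -/
theorem G_nonneg_at
    (hG : ∀ j (s t : ℝ), G (j + 1) s t = (((Q j : ℕ) : ℝ) ^ t + G j s t) ^ 2 - (((Q j : ℕ) : ℝ) ^ t) ^ 2)
    {s t : ℝ} (h0 : 0 ≤ G 0 s t) : ∀ j, 0 ≤ G j s t := by
  intro j
  induction j with
  | zero => exact h0
  | succ j ih =>
    rw [hG]
    have hq : 0 ≤ ((Q j : ℕ) : ℝ) ^ t := Real.rpow_nonneg (Nat.cast_nonneg _) _
    nlinarith

/-- **Free re-anchoring**: `Q_{j+1} = Q_j² + 2L_j²` (from `Q + 2L = r`, `r' = r²`,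
`L' = (Q+L)² − Q²`). [cite: Pan1984, Props. 16.2–16.5] [cite: KnuthTAOCP2, §4.6.4, Ex. 67(g)] -/
theorem anchor_sq (hsum : ∀ j, Q j + 2 * L j = r j)
    (hL : ∀ j, L (j + 1) = (Q j + L j) ^ 2 - Q j ^ 2) (hr : ∀ j, r (j + 1) = r j ^ 2) (j : ℕ) :
    ((Q (j + 1) : ℕ) : ℝ) = ((Q j : ℕ) : ℝ) ^ 2 + 2 * ((L j : ℕ) : ℝ) ^ 2 := by
  have h1 : ((Q (j + 1) : ℕ) : ℝ) + 2 * L (j + 1) = r (j + 1) := by exact_mod_cast hsum (j + 1)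
  have h2 : ((Q j : ℕ) : ℝ) + 2 * L j = r j := by exact_mod_cast hsum j
  have hle : Q j ^ 2 ≤ (Q j + L j) ^ 2 := Nat.pow_le_pow_left (by omega) 2
  have h3 : ((L (j + 1) : ℕ) : ℝ) = (((Q j : ℕ) : ℝ) + L j) ^ 2 - ((Q j : ℕ) : ℝ) ^ 2 := by
    rw [hL j, Nat.cast_sub hle]
    push_cast
    ring
  have h4 : ((r (j + 1) : ℕ) : ℝ) = ((r j : ℕ) : ℝ) ^ 2 := by
    rw [hr j]
    push_cast
    ring
  rw [h3, h4, ← h2] at h1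
  linear_combination h1

/-- `L_j ≤ Q_j` along an improvable chain with `3L₀ ≤ r₀` (`m_j = L_j/r_j ≤ 1/3`,
kernel XXXI-A `improvable_normalForm`). [cite: Pan1984, Props. 16.2–16.5] -/
theorem L_le_Q (hsum : ∀ j, Q j + 2 * L j = r j) (hQ1 : ∀ j, 1 ≤ Q j)
    (hm0 : 3 * L 0 ≤ r 0) (hL : ∀ j, L (j + 1) = (Q j + L j) ^ 2 - Q j ^ 2)
    (hr : ∀ j, r (j + 1) = r j ^ 2) (j : ℕ) :
    ((L j : ℕ) : ℝ) ≤ ((Q j : ℕ) : ℝ) := by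
  obtain ⟨hrpos, -, hm3, -, -⟩ := improvable_normalForm r Q L hsum hQ1 hm0 hL hr j
  have h2 : ((Q j : ℕ) : ℝ) + 2 * L j = r j := by exact_mod_cast hsum j
  rw [div_le_iff₀ hrpos] at hm3
  linarith

/-- **The anchor gain is small**: `Q_{j+1}^τ − (Q_j^τ)² ≤ (3^τ − 1)·Q_j^{2τ} ≤ 2τ·r_{j+1}^τ`
for `0 ≤ τ ≤ 1` (`Q_{j+1} = Q_j² + 2L_j² ≤ 3Q_j²`, `Q_j² ≤ Q_{j+1} ≤ r_{j+1}`).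
[cite: Pan1984, Props. 16.2–16.5] [cite: Stothers2010, Thm. 8] -/
theorem gain_le (hsum : ∀ j, Q j + 2 * L j = r j) (hQ1 : ∀ j, 1 ≤ Q j)
    (hm0 : 3 * L 0 ≤ r 0) (hL : ∀ j, L (j + 1) = (Q j + L j) ^ 2 - Q j ^ 2)
    (hr : ∀ j, r (j + 1) = r j ^ 2) {τ : ℝ} (hτ0 : 0 ≤ τ) (hτ1 : τ ≤ 1) (j : ℕ) :
    ((Q (j + 1) : ℕ) : ℝ) ^ τ - (((Q j : ℕ) : ℝ) ^ τ) ^ 2 ≤ 2 * τ * ((r (j + 1) : ℕ) : ℝ) ^ τ := by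
  have hQ0 : 0 ≤ ((Q j : ℕ) : ℝ) := Nat.cast_nonneg _
  have hQ'0 : 0 ≤ ((Q (j + 1) : ℕ) : ℝ) := Nat.cast_nonneg _
  have hL0 : 0 ≤ ((L j : ℕ) : ℝ) := Nat.cast_nonneg _
  have hsq := anchor_sq r Q L hsum hL hr j
  have hLQ := L_le_Q r Q L hsum hQ1 hm0 hL hr j
  -- `Q' ≤ 3 Q²`, `Q² ≤ Q'`, `Q' ≤ r'`
  have hQ'3 : ((Q (j + 1) : ℕ) : ℝ) ≤ 3 * ((Q j : ℕ) : ℝ) ^ 2 := by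
    rw [hsq]
    nlinarith [mul_le_mul hLQ hLQ hL0 hQ0]
  have hQ2Q' : ((Q j : ℕ) : ℝ) ^ 2 ≤ ((Q (j + 1) : ℕ) : ℝ) := by rw [hsq]; nlinarith
  have hQ'r : ((Q (j + 1) : ℕ) : ℝ) ≤ ((r (j + 1) : ℕ) : ℝ) := by
    have := hsum (j + 1)
    exact_mod_cast (by omega : Q (j + 1) ≤ r (j + 1))
  rw [rpow_sq_eq hQ0]
  have hP0 : 0 ≤ (((Q j : ℕ) : ℝ) ^ 2) ^ τ := Real.rpow_nonneg (pow_nonneg hQ0 2) _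
  have h1 : ((Q (j + 1) : ℕ) : ℝ) ^ τ ≤ (3 : ℝ) ^ τ * (((Q j : ℕ) : ℝ) ^ 2) ^ τ := by
    rw [← Real.mul_rpow (by norm_num) (pow_nonneg hQ0 2)]
    exact Real.rpow_le_rpow hQ'0 hQ'3 hτ0
  have h2 : ((3 : ℝ) ^ τ - 1) * (((Q j : ℕ) : ℝ) ^ 2) ^ τ ≤ 2 * τ * (((Q j : ℕ) : ℝ) ^ 2) ^ τ :=
    mul_le_mul_of_nonneg_right (three_rpow_sub_one_le hτ0 hτ1) hP0
  have h3 : (((Q j : ℕ) : ℝ) ^ 2) ^ τ ≤ ((r (j + 1) : ℕ) : ℝ) ^ τ :=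
    Real.rpow_le_rpow (pow_nonneg hQ0 2) (hQ2Q'.trans hQ'r) hτ0
  have h4 : 2 * τ * (((Q j : ℕ) : ℝ) ^ 2) ^ τ ≤ 2 * τ * ((r (j + 1) : ℕ) : ℝ) ^ τ :=
    mul_le_mul_of_nonneg_left h3 (by positivity)
  nlinarith

/-- **THE ANCHOR-GAIN INVARIANT.**  Along a chain with `r' = r²` and `G' = (Q^t + G)² − (Q^t)²`
the full normalised readout `F_j = (Q_j^t + G_j)/r_j` satisfies
`F_{j+1} = F_j² + (Q_{j+1}^t − Q_j^{2t})/r_{j+1}` exactly; hence a margin `Q_0^t + G_0 ≤ (1−x)·r_0`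
with `0 ≤ x ≤ 1/2` propagates to EVERY stage, `Q_j^t + G_j ≤ (1−x)·r_j`, provided each anchor gain
is at most `(x/2)·r_{j+1}` (because `(1−x)² + x/2 ≤ 1 − x`). [cite: Pan1984, Props. 16.2–16.5]
[cite: Stothers2010, Thm. 8] -/
theorem gain_invariant (hr : ∀ j, r (j + 1) = r j ^ 2)
    (hG : ∀ j (s t : ℝ), G (j + 1) s t = (((Q j : ℕ) : ℝ) ^ t + G j s t) ^ 2 - (((Q j : ℕ) : ℝ) ^ t) ^ 2)
    {s τ x : ℝ} (hx0 : 0 ≤ x) (hx1 : x ≤ 1 / 2) (h0 : 0 ≤ G 0 s τ)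
    (hbase : ((Q 0 : ℕ) : ℝ) ^ τ + G 0 s τ ≤ (1 - x) * r 0)
    (hgain : ∀ j, ((Q (j + 1) : ℕ) : ℝ) ^ τ - (((Q j : ℕ) : ℝ) ^ τ) ^ 2 ≤ x / 2 * r (j + 1)) :
    ∀ j, ((Q j : ℕ) : ℝ) ^ τ + G j s τ ≤ (1 - x) * r j := by
  intro j
  induction j with
  | zero => exact hbase
  | succ j ih =>
    have hGj := G_nonneg_at Q G hG h0 j
    have hq : 0 ≤ ((Q j : ℕ) : ℝ) ^ τ := Real.rpow_nonneg (Nat.cast_nonneg _) _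
    have hF0 : 0 ≤ ((Q j : ℕ) : ℝ) ^ τ + G j s τ := add_nonneg hq hGj
    have hsq : (((Q j : ℕ) : ℝ) ^ τ + G j s τ) ^ 2 ≤ ((1 - x) * r j) ^ 2 := pow_le_pow_left₀ hF0 ih 2
    have hr' : ((r (j + 1) : ℕ) : ℝ) = ((r j : ℕ) : ℝ) ^ 2 := by
      rw [hr j]
      push_cast
      ring
    have hg := hgain j
    rw [hG j s τ]
    rw [hr'] at hg ⊢
    have key : (x / 2 + (1 - x) ^ 2) * ((r j : ℕ) : ℝ) ^ 2 ≤ (1 - x) * ((r j : ℕ) : ℝ) ^ 2 := by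
      have h12 : 0 ≤ 1 / 2 - x := by linarith
      nlinarith [mul_nonneg (mul_nonneg hx0 h12) (sq_nonneg ((r j : ℕ) : ℝ))]
    nlinarith

/-! ## §3 Flat-corner rigidity of the `E₃` tower -/

/-- **FLAT-CORNER RIGIDITY (the `E₃` tower of record: `r₀ = 10`, `Q₀ = 4`, `G₀(s,t) = 3^s`).**
For `0 ≤ δ ≤ 1/100`, `0 ≤ τ ≤ 1/100` and `τ ≤ 3δ`, EVERY readout of the isolated improvable
squaring tower passes at the point `(s,t) = (2 − δ, τ)` next to the flat corner `(2,0)`: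
`G_j(2−δ, τ) ≤ r_j` for all `j` (indeed `Q_j^τ + G_j(2−δ,τ) ≤ (1 − x)·r_j`,
`x = (8.91δ − 2τ)/10`).  Base margin: `4^τ + 3^(2−δ) ≤ 1 + 2τ + 9(1 − 0.99δ)`; anchor gains
`≤ 2τ·r_{j+1}^τ ≤ 2τ·100^(τ−1)·r_{j+1} ≤ 0.0236τ·r_{j+1} ≤ (x/2)·r_{j+1}` (`r_{j+1} ≥ 100`).  So
near `(2,0)` the tower certifies nothing beyond the linear wedge of its base: points with `τ > δ`
— violating the unit roof `θ₁ ≤ (1−θ₀) + (1−θ₂)` of `ω = 2` — pass every stage.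
[cite: Schonhage1981, §5] [cite: Pan1984, Props. 16.2–16.5] [cite: Stothers2010, Thm. 8] -/
theorem flatCorner_pass (h0r : r 0 = 10) (h0Q : Q 0 = 4) (h0G : ∀ s t : ℝ, G 0 s t = (3 : ℝ) ^ s)
    (hsum : ∀ j, Q j + 2 * L j = r j) (hQ1 : ∀ j, 1 ≤ Q j)
    (hL : ∀ j, L (j + 1) = (Q j + L j) ^ 2 - Q j ^ 2) (hr : ∀ j, r (j + 1) = r j ^ 2)
    (hG : ∀ j (s t : ℝ), G (j + 1) s t = (((Q j : ℕ) : ℝ) ^ t + G j s t) ^ 2 - (((Q j : ℕ) : ℝ) ^ t) ^ 2)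
    {δ τ : ℝ} (hδ0 : 0 ≤ δ) (hδ1 : δ ≤ 1 / 100) (hτ0 : 0 ≤ τ) (hτ1 : τ ≤ 1 / 100)
    (hτδ : τ ≤ 3 * δ) :
    ∀ j, G j (2 - δ) τ ≤ r j := by
  have hm0 : 3 * L 0 ≤ r 0 := by
    have := hsum 0
    rw [h0Q, h0r] at this
    omega
  obtain ⟨x, hx⟩ : ∃ x : ℝ, x = (891 * δ - 200 * τ) / 1000 := ⟨_, rfl⟩
  have hx0 : 0 ≤ x := by rw [hx]; exact div_nonneg (by linarith) (by norm_num)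
  have hx1 : x ≤ 1 / 2 := by rw [hx, div_le_iff₀ (by norm_num : (0 : ℝ) < 1000)]; linarith
  -- the base margin
  have hbase : ((Q 0 : ℕ) : ℝ) ^ τ + G 0 (2 - δ) τ ≤ (1 - x) * r 0 := by
    rw [h0Q, h0G, h0r]
    push_cast
    have h4 := four_rpow_le hτ0 (by linarith)
    have h3 : (3 : ℝ) ^ (2 - δ) = 9 * (3 : ℝ) ^ (-δ) := by
      rw [sub_eq_add_neg, Real.rpow_add (by norm_num : (0 : ℝ) < 3), Real.rpow_two]
      norm_num
    have h3' := three_rpow_neg_le hδ0 hδ1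
    rw [h3, hx]
    linarith
  -- the anchor gains
  have hgain : ∀ j, ((Q (j + 1) : ℕ) : ℝ) ^ τ - (((Q j : ℕ) : ℝ) ^ τ) ^ 2 ≤ x / 2 * r (j + 1) := by
    intro j
    have hg := gain_le r Q L hsum hQ1 hm0 hL hr hτ0 (by linarith) j
    have hr100 : (100 : ℝ) ≤ ((r (j + 1) : ℕ) : ℝ) := by
      rw [r_eq_pow r hr (j + 1), h0r]
      have h2 : 2 ≤ 2 ^ (j + 1) := by
        calc 2 = 2 ^ 1 := by norm_num
          _ ≤ 2 ^ (j + 1) := Nat.pow_le_pow_right (by norm_num) (by omega)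
      exact_mod_cast (show 100 ≤ 10 ^ 2 ^ (j + 1) from
        le_trans (by norm_num : 100 ≤ 10 ^ 2) (Nat.pow_le_pow_right (by norm_num) h2))
    have hrpos : (0 : ℝ) < ((r (j + 1) : ℕ) : ℝ) := by linarith
    have e : ((r (j + 1) : ℕ) : ℝ) ^ τ = ((r (j + 1) : ℕ) : ℝ) ^ (τ - 1) * ((r (j + 1) : ℕ) : ℝ) := by
      rw [← Real.rpow_add_one hrpos.ne' (τ - 1), sub_add_cancel]
    have hanti : ((r (j + 1) : ℕ) : ℝ) ^ (τ - 1) ≤ (100 : ℝ) ^ (τ - 1) :=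
      Real.rpow_le_rpow_of_nonpos (by norm_num) hr100 (by linarith)
    have h100 : (100 : ℝ) ^ (τ - 1) ≤ (1 + 18 * τ) / 100 := by
      have e1 : (100 : ℝ) ^ (τ - 1) = (100 : ℝ) ^ τ / 100 := by
        rw [← Real.rpow_sub_one (by norm_num : (100 : ℝ) ≠ 0)]
      rw [e1, div_le_div_iff_of_pos_right (by norm_num : (0 : ℝ) < 100)]
      exact hundred_rpow_le hτ0 (by linarith)
    have h5 : ((r (j + 1) : ℕ) : ℝ) ^ τ ≤ (1 + 18 * τ) / 100 * ((r (j + 1) : ℕ) : ℝ) := by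
      rw [e]
      exact mul_le_mul_of_nonneg_right (hanti.trans h100) hrpos.le
    have h6 : 2 * τ * ((1 + 18 * τ) / 100) ≤ x / 2 := by
      rw [hx]
      have hττ : τ * τ ≤ τ * (1 / 100) := mul_le_mul_of_nonneg_left hτ1 hτ0
      nlinarith
    calc ((Q (j + 1) : ℕ) : ℝ) ^ τ - (((Q j : ℕ) : ℝ) ^ τ) ^ 2
        ≤ 2 * τ * ((r (j + 1) : ℕ) : ℝ) ^ τ := hg
      _ ≤ 2 * τ * ((1 + 18 * τ) / 100 * ((r (j + 1) : ℕ) : ℝ)) :=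
          mul_le_mul_of_nonneg_left h5 (by positivity)
      _ = 2 * τ * ((1 + 18 * τ) / 100) * ((r (j + 1) : ℕ) : ℝ) := by ring
      _ ≤ x / 2 * ((r (j + 1) : ℕ) : ℝ) := mul_le_mul_of_nonneg_right h6 hrpos.le
  intro j
  have h0 : 0 ≤ G 0 (2 - δ) τ := by rw [h0G]; positivity
  have hinv := gain_invariant r Q G hr hG hx0 hx1 h0 hbase hgain j
  have hq : 0 ≤ ((Q j : ℕ) : ℝ) ^ τ := Real.rpow_nonneg (Nat.cast_nonneg _) _
  have hrj : (0 : ℝ) ≤ ((r j : ℕ) : ℝ) := Nat.cast_nonneg _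
  nlinarith [mul_nonneg hx0 hrj]

end Chain

end Summit.MatrixMultiplication.MatrixMultiplication.Theorems.FarEdgeDescentFlatCorner

end
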